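import Mathlib
import Summits.KontsevichZagierPeriods.Zeta5Search.RecordRayFaceKit
import Summits.KontsevichZagierPeriods.Zeta5Search.RecordRayLevels
import HarnessLib

/-!
# ζ(5) search — record-ray LETTERS windows at shift m = 2 as RAY FACE KIT certificates (file S, faces 163–163; p3 g7, MACHINE-GENERATED)

HONEST FRAMING: systematic search; no irrationality claim unless certified.  Cell `pub-zeta5`, prover seat p3, generation 7; generator
`code/facekit_rec.py` + `code/emit_kit.py` (HOME `pub-zeta5-p3-g7/`): faces from p3 g6's `facecert` (exact splitting where the order
of the 17 cuts changes; floor `N₀`), cuts read off one lattice point, Python port of `RayFaceKit.coverOf` cross-checked against facecert's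
interval types and brute force (0 mismatches).  For each face: two `FaceCert` literals (P1 g14's `RayFaceKit`) and the `window` theorem
in p3 g6's `RecordLetters.<Tag>.window` shape, proved by `RecordRayLevels.record_*` (THEOREM LB + Lemma-D / double-drop / collinearity /
law-A3 bonus BY NAME) on the kit cover `RecordRayFaceKit.rec_cover … (by decide +kernel)`.  Windows = census g37 REC-BRICKS-LEDGER §4
letters windows at `θ = p/n ∈ (1/3, 1/2)`; consumed as kind-5 rows (`RecordRayDenominatorsBricksClassK`).  Integer bookkeeping of net
exponents; every kernel exponent these feed stays `< 1` — no irrationality content.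
-/

open Finset

namespace Summit.KontsevichZagierPeriods.Zeta5Search.RecordLetters

open Summit.KontsevichZagierPeriods.Zeta5Search.ClusterValuation
open Summit.KontsevichZagierPeriods.Zeta5Search.CasoratianValuation (casoratian)
open Summit.KontsevichZagierPeriods.Zeta5Search.ClassTypeCover
open Summit.KontsevichZagierPeriods.Zeta5Search.RayFaceKit (FaceCert Kind)

/-- Face certificate of window M2F163 (`θ ∈ (1/3, 41/122)`, shift m = 2), parity `n ≡ 0 (mod 2)`. -/
def certM2F163R0 : FaceCert :=
  ⟨⟨1, 3, 41, 122, 256, 0⟩,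
   [⟨.cenLo, 0⟩, ⟨.cenHi, 0⟩, ⟨.top, 122⟩, ⟨.hi 6, 90⟩, ⟨.hi 5, 87⟩, ⟨.hi 4, 84⟩, ⟨.hi 3, 81⟩, ⟨.hi 2, 78⟩, ⟨.hi 1, 75⟩, ⟨.hi 0, 72⟩, ⟨.lo 0, 51⟩, ⟨.lo 1, 48⟩, ⟨.lo 2, 45⟩, ⟨.lo 3, 42⟩, ⟨.lo 4, 39⟩, ⟨.lo 5, 36⟩, ⟨.lo 6, 33⟩]⟩

/-- Face certificate of window M2F163, parity `n ≡ 1 (mod 2)`. -/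
def certM2F163R1 : FaceCert :=
  ⟨⟨1, 3, 41, 122, 256, 1⟩,
   [⟨.top, 122⟩, ⟨.hi 6, 90⟩, ⟨.hi 5, 87⟩, ⟨.hi 4, 84⟩, ⟨.hi 3, 81⟩, ⟨.hi 2, 78⟩, ⟨.hi 1, 75⟩, ⟨.hi 0, 72⟩, ⟨.cenLo, 0⟩, ⟨.cenHi, 0⟩, ⟨.lo 0, 51⟩, ⟨.lo 1, 48⟩, ⟨.lo 2, 45⟩, ⟨.lo 3, 42⟩, ⟨.lo 4, 39⟩, ⟨.lo 5, 36⟩, ⟨.lo 6, 33⟩]⟩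

namespace M2F163

set_option maxHeartbeats 800000 in
/-- **Window M2F163** (census window (1/3,41/122], letters J1 (0.0027 nats), e_ker 8 → e_let 7; laws J/J for `n` even/odd): `-298 ≤ v_p(Cas₇(b(n)))` for `n ≥ 256`, `p` prime, `1·n < 3·p`, `122·p < 41·n`,
`41n + 2 < p²`. -/
theorem window (n p : ℕ) (hn : 256 ≤ n) (hp : p.Prime) (hA : 1 * n < 3 * p) (hB : 122 * p < 41 * n)
    (hsq : 41 * n + 2 < p ^ 2) (hne : casoratian (bRec n) 7 ≠ 0) : (-298 : ℤ) ≤ padicValRat p (casoratian (bRec n) 7) := by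
  haveI := Fact.mk hp
  have hp2 : p % 2 = 1 := Nat.odd_iff.1 (hp.odd_of_ne_two (by omega))
  have hp5 : 5 ≤ p := by omega
  have hpd : p ≤ 25 * n := by omega
  have hn1 : 1 ≤ n := by omega
  rcases Nat.mod_two_eq_zero_or_one n with hr | hr
  · exact record_J hn1 hp hp5 hpd hsq hr (RecordRayFaceKit.rec_cover (c := certM2F163R0) (by decide +kernel)
        ⟨hn, by show 1 * n + 1 ≤ 3 * p; omega, by show 122 * p + 1 ≤ 41 * n; omega, hr, hp2⟩) (m := -151) (B := -148) (A' := -150) (B' := -147)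
      (c := -298) (by decide +kernel) (by norm_num) (by decide +kernel) (by decide +kernel) (by norm_num) (by norm_num)
      (by norm_num) (by norm_num) hne
  · exact record_J hn1 hp hp5 hpd hsq hr (RecordRayFaceKit.rec_cover (c := certM2F163R1) (by decide +kernel)
        ⟨hn, by show 1 * n + 1 ≤ 3 * p; omega, by show 122 * p + 1 ≤ 41 * n; omega, hr, hp2⟩) (m := -151) (B := -148) (A' := -150) (B' := -147)
      (c := -298) (by decide +kernel) (by norm_num) (by decide +kernel) (by decide +kernel) (by norm_num) (by norm_num)
      (by norm_num) (by norm_num) hne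

end M2F163

end Summit.KontsevichZagierPeriods.Zeta5Search.RecordLetters
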